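/-
Copyright (c) 2026 the pub-hodgecm-mathlib formalisation cell (harness21).  Prover seat hodgecm-mathlib-K2Liu-p07 (g3), Track B «K2-LIT»,
#184♮ = hLiu418 = `stmt-HodgeConjecture-24832`; #42S payer road, organ (σ) (local value identity), OWNER WORD σ19 payer «V7a WITH TAIL», brick T2
(uniform right-invariance of `K₀`-flat families) — K2Liu-p09 (g6) «p07 pens V7a-with-tail» 2026-09-04 14:15Z.
-/
import Summits.HodgeConjecture.HodgeConjecture.Theorems.K2LiuA7ValueFunctional     -- ★ V1: flat families (`apply_eq_cpow_mul_apply`), `IsLocalSiegelSection`, `IsSmooth`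
import HarnessLib

/-!
# Crux `HLiu418`, #42S organ (σ), «V7a with tail», brick T2: A `K₀`-FLAT FAMILY THROUGH A SMOOTH SECTION IS RIGHT-INVARIANT UNDER ONE OPEN SUBGROUP,
# UNIFORMLY IN `s`

Cell `hodgecm-mathlib`, crux item hLiu418 = `stmt-HodgeConjecture-24832`; squad K2 ∕ K2Liu; LEAD F0P6-plan (g14), organ lead (σ) K2Liu-p09 (g6);
prover K2Liu-p07 (g3).  THEOREMS ONLY (no `def`, no instance, no notation, no named-fact hypothesis, no `sorry`); lane
`--supports stmt-HodgeConjecture-24832 --as helper`.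

WHY.  The tail of the intertwining integral `M_v(s)(f s)(1) = ∫_{N_Δ} f s (w_Δ u) dνN` of a `K₀`-flat family `f` (★ V7a handles the compact part) is read off
the values `f s (w_Δ u)` for `u → ∞`, where `w_Δ u = p(u) · n⁻(u)` with `n⁻(u) → 1`; one needs `f s (g · n⁻) = f s (g)` for `n⁻` in ONE open subgroup `V`,
for ALL `s` at once.  This holds with `V := K₀ ∩ Stab(f s₁)`: by Iwasawa `h = p k` (`hIw`), the Siegel law in `p`, flatness on `k·u ∈ K₀`, and the
smoothness of the member `f s₁`.
* `apply_mul_eq_of_flat` — `f s (h u) = f s h` for `u ∈ K₀` with `f s₁ (k u) = f s₁ k` for all `k ∈ K₀`;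
* **`exists_openSubgroup_forall_apply_mul_eq`** — `∃ V` open, `V ≤ K₀`, `∀ s h, ∀ u ∈ V, f s (h u) = f s h`;
* `apply_one_eq_of_flat` — `f s 1 = f s₁ 1`.
References: [Casselman1980] §3; [KudlaSweet1997] §1; [HarrisKudlaSweet1996] §1 (1.15).
HONEST LABEL.  Count-neutral helper: `HC_CM` is proved only modulo the 7 printed citations (2 remaining named inputs: hLiu418 = `stmt-HodgeConjecture-24832`,
h413 = `stmt-HodgeConjecture-24833`) until rung 0 closes.
-/

set_option autoImplicit false
set_option linter.dupNamespace false -- the mandated namespace repeats `HodgeConjecture.HodgeConjecture`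

noncomputable section

open NumberField IsDedekindDomain Topology
open Literature.NumberTheory.Automorphic Literature.NumberTheory.Automorphic.UnitaryGroup
open Literature.NumberTheory.GelbartRogawski1991.UnitaryDualPair.LocalSplitting
open Literature.NumberTheory.K2Lit.LocalSiegelDoubled
open Summit.HodgeConjecture.HodgeConjecture.Cruxes.HLiu418.K2LiuLocalSiegel
open Summit.HodgeConjecture.HodgeConjecture.Cruxes.HLiu418.K2LiuA7ValueFunctional

namespace Summit.HodgeConjecture.HodgeConjecture.Cruxes.HLiu418.K2LiuFlatFamilyInvariance

variable (F : Type) [Field F] [NumberField F] (E : Type) [Field E] [NumberField E] [Algebra F E]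
  [Algebra.IsQuadraticExtension F E] (c : E ≃ₐ[F] E)
  {δ : E} (hcδ : c δ = -δ) (hδ : δ ≠ 0) {d : F} (hd : δ * δ = algebraMap F E d) (v : HeightOneSpectrum (𝓞 F)) (n : ℕ)
  {T₀ : Matrix (Fin n) (Fin n) F} (hT₀ : T₀.IsSymm) {JD : Matrix (Fin (n + n)) (Fin (n + n)) E} (hJD : JD = (gramD F n T₀).map (algebraMap F E))
  (χv : ∀ w : PlacesOver E v, (w.1.adicCompletion E)ˣ →* ℂˣ)
  (K₀ : Subgroup (UnitaryGroup.localPi E c (n + n) JD v))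
  (hIw : ∀ x : UnitaryGroup.localPi E c (n + n) JD v, ∃ p, IsSiegelDelta F E c hcδ hδ hd v n hT₀ hJD p ∧ ∃ k ∈ K₀, x = p * k)
  {f : ℂ → UnitaryGroup.localPi E c (n + n) JD v → ℂ} (hSieg : ∀ s, IsLocalSiegelSection F E c hcδ hδ hd v n hT₀ hJD χv s (f s))
  (hflat : ∀ s s' : ℂ, ∀ k ∈ K₀, f s k = f s' k) (s₁ : ℂ)

omit [Algebra.IsQuadraticExtension F E] in
include hflat in
/-- `f s 1 = f s₁ 1` for a `K₀`-flat family (`1 ∈ K₀`). [cite: Casselman1980, §3] -/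
theorem apply_one_eq_of_flat (s : ℂ) : f s 1 = f s₁ 1 := hflat s s₁ 1 K₀.one_mem

include hIw hSieg hflat in
/-- **RIGHT-INVARIANCE TRANSPORTS ALONG A FLAT FAMILY**: if the member `f s₁` satisfies `f s₁ (k u) = f s₁ k` for all `k ∈ K₀` (some `u ∈ K₀`), then `f s (h u) = f s h`
for EVERY `s` and `h` — Iwasawa `h = p k`, Siegel law in `p`, flatness at `k u, k ∈ K₀`. [cite: Casselman1980, §3] [cite: KudlaSweet1997, §1] -/
theorem apply_mul_eq_of_flat {u : UnitaryGroup.localPi E c (n + n) JD v} (hu : u ∈ K₀) (hφ : ∀ k ∈ K₀, f s₁ (k * u) = f s₁ k)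
    (s : ℂ) (h : UnitaryGroup.localPi E c (n + n) JD v) : f s (h * u) = f s h := by
  obtain ⟨p, hp, k, hk, rfl⟩ := hIw h
  rw [mul_assoc, hSieg s p hp (k * u), hSieg s p hp k, hflat s s₁ (k * u) (K₀.mul_mem hk hu), hφ k hk, ← hflat s s₁ k hk]

include hIw hSieg hflat in
/-- **ONE OPEN SUBGROUP FOR ALL `s`**: a `K₀`-flat family of Siegel sections whose member `f s₁` is smooth is right-invariant under an open subgroup `V ≤ K₀`,
uniformly in `s` (`V := K₀ ∩ U`, `U` an open stabiliser of `f s₁`). [cite: Casselman1980, §3] [cite: HarrisKudlaSweet1996, §1 (1.15)] -/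
theorem exists_openSubgroup_forall_apply_mul_eq (hK₀ : IsOpen (K₀ : Set (UnitaryGroup.localPi E c (n + n) JD v))) (hsm : IsSmooth F E c v n (f s₁)) :
    ∃ V : OpenSubgroup (UnitaryGroup.localPi E c (n + n) JD v), (V : Subgroup (UnitaryGroup.localPi E c (n + n) JD v)) ≤ K₀ ∧
      ∀ (s : ℂ) (h u : UnitaryGroup.localPi E c (n + n) JD v), u ∈ (V : Subgroup (UnitaryGroup.localPi E c (n + n) JD v)) → f s (h * u) = f s h := by
  obtain ⟨U, hU⟩ := hsm
  refine ⟨⟨K₀ ⊓ (U : Subgroup (UnitaryGroup.localPi E c (n + n) JD v)), hK₀.inter U.isOpen⟩, inf_le_left, fun s h u hu => ?_⟩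
  exact apply_mul_eq_of_flat F E c hcδ hδ hd v n hT₀ hJD χv K₀ hIw hSieg hflat s₁ (Subgroup.mem_inf.1 hu).1 (fun k _ => hU k u (Subgroup.mem_inf.1 hu).2) s h

end Summit.HodgeConjecture.HodgeConjecture.Cruxes.HLiu418.K2LiuFlatFamilyInvariance
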